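/-
Copyright (c) 2026 the pub-hodgecm-mathlib formalisation cell (harness21).  Prover seat hodgecm-mathlib-F0P3a-p08 (g19): «S3-ram» seeding wave (LEAD F0P3a-plan (g12), owner
F0P3a-p06 (g15)), row (e2)(b) «[T2-c]-ram» (A-p19 (g26) PLAN-T2c-ram-layer3 ∕ CERT «[T2-c]-ram», inherited 22:13:38Z), LAYER 3 (iii): THE UNIT INDEX `[C : R^×]`; 2026-09-01.
-/
import Literature.NumberTheory.Automorphic.TypeTwoOrderFixedUnitIndexRamifiedBase      -- ★ (this seat) (ii-d): `relIndex_units_fixed_mul_sq_eq_typeA`, `relIndex_units_fixed_mul_eq_typeB`; brings ★ (ii-c) p847046, ★ (ii-a) p847012, ★ p846912, ★ C3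
import Literature.NumberTheory.LocalFields.InvolutionNormIndexProductRamifiedBase        -- ★ p846982 (this seat) (ii-e): `[G : W] = 4 ∕ 2`, `[H : H ∩ W] = 2` dichotomy, index identity; brings ★ B-p10
import HarnessLib

/-!
# The unit index of the type-(2) order at a TAMELY RAMIFIED base: `[C : R^×] = 2·q^{(N+n−1)∕2}` (type A), `(q+1)·q^{(N+n−2)∕2}` (type B)
# (Rogawski 1990 §4.9; Serre, *Local Fields* Ch. V §2–§3; Neukirch I §12)

Topic `NumberTheory/Automorphic`; namespace `Literature.NumberTheory.Automorphic`.  THEOREMS ONLY (no definition, no instance, no notation, no named fact, no `sorry`); (D0)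
currency of ★ p846912 ∕ p847012 ∕ p847046 ∕ p847083, with completeness ∕ finiteness of `𝒪_E`, `O₁` as instance hypotheses (at the CM place: `𝒪[L_w]`, `𝒪[M_{w₁}]`).
Cell `pub/hodgecm-mathlib` (D-0151), crux H413 = `stmt-HodgeConjecture-24833`; «S3-ram» row (e2)(b) «[T2-c]-ram» = the ramified-base input of STUB A₂ (P-2-ram skeleton,
A-p12 (g23)): the count of self-dual `δ`-cyclic lattices on the good type-(2) class, `[C : R^×]`, `C = {c ∈ Λ^× : c·c⋆ ∈ R^×}`, `Λ = 𝒪_E × 𝒪_M`, `R = 𝒪_E[(u, λ)]`.  THIS FILE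
CLOSES LAYER 3 of A-p19 (g26)'s PLAN (CERT «[T2-c]-ram», certified at `q ∈ {3, 5}`):
  **TYPE A (`σ₁θ = θ`, `N + n` odd): `[C : R^×] = 2·q^{(N+n−1)∕2}`;  TYPE B (`σ₁θ = −θ`, `N + n` even): `[C : R^×] = (q+1)·q^{(N+n−2)∕2}`**  (`q = #𝓀_F = #𝓀_E`).
ASSEMBLY: ★ C2a `[C : V]·[W : V∩W] = [Λ^× : V]` (`V = R^×`, `W = N(Λ^×)`); ★ p846912 `[Λ^× : V] = (q²−1)q^{N+n−2}`; ★ p846982 §4 `[W : V∩W]·[G : W] = [V⊓G : V∩W]·[G : V⊓G]`,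
§3 `[G : W] = 4 ∕ 2` (`𝒪_E` ramified-type by the coordinate model; `O₁` ramified-type in A — `σ₁ − id ≡ 0 (mod jΠ)` —, unramified-type in B — skew unit `σ₁θ − θ = −2θ`),
§2 `[V⊓G : V∩W] = 2` with witness `η₀ = (ε, jε)`, `ε = ιO ε₀ = θ²` (σ-fixed unit of `R`, non-norm in `𝒪_E`; in type A `jε = θ·σ₁θ` IS a norm in `O₁`, so `ja ∈ N(O₁^×)` for every fixed
unit `a` of `𝒪_E` and the second coordinate of a fixed unit of `R` — `≡ j(first)` mod `𝔪_{O₁}`, §1 — is a `σ₁`-norm); ★ p847083 `[G : V⊓G]`.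
PARITY (ref5 R-254): `Odd ∕ Even (N + n)` is a torus-datum input («type A ⟺ N odd; n = 2·ord_M(u − λ) even», CERT §Setting) to be discharged by the (e2)-ram one-place transport
(A-p12 (g23), ★ p846662 pattern; cf. F0P3a-p02 (g16) «TYPE-(2) DESCENT PARITY») from the STRUCTURE of `(N, n)`, not from the index identities.
HONEST LABEL: HC_CM is proved only modulo the 2 remaining named inputs (hLiu418 24832, h413 24833) until rung 0 closes; unconditional commutative algebra, count-neutral.
* §1 `snd_sub_map_fst_mem_of_mem_range`, `map_sub_self_mem_maximalIdeal_of_coord`, `map_sub_self_mem_maximalIdeal_typeA`, `not_isSquare_residue_of_forall_isUnit`,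
  `exists_mul_map_eq_map_of_fixed_typeA` (and ★ `mem_maximalIdeal_of_valuation_eq_pow`).
* §2 **`relIndex_units_comap_norm_eq_typeA`**, **`relIndex_units_comap_norm_eq_typeB`**.

## References
* [Rogawski1990] J. D. Rogawski, *Automorphic Representations of Unitary Groups in Three Variables* (1990): §4.9 Lemma 4.9.3 p. 56, Prop. 4.9.1 (b) p. 55.
* [SerreLocalFields1979] J.-P. Serre, *Local Fields*, GTM 67 (1979): Ch. V §2 Prop. 3; Ch. V §3 Prop. 5 and Cor. 2 p. 86.
* [Neukirch1999] J. Neukirch, *Algebraic Number Theory* (1999): Ch. I §12 (orders, conductor, unit indices).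
* [Jacobowitz1962] R. Jacobowitz, *Hermitian forms over local fields*, Amer. J. Math. 84 (1962): §7–§8.
-/

set_option autoImplicit false

noncomputable section

open scoped ValuativeRel
open Polynomial ValuativeRel

namespace Literature.NumberTheory.Automorphic

open Literature.RingTheory.GaloisAlgebras Literature.NumberTheory.LocalFields.RamifiedQuadraticNorm

variable {F E : Type*} [Field F] [ValuativeRel F] [Field E] [ValuativeRel E] {O₁ : Type*} [CommRing O₁]
  (ιO : 𝒪[F] →+* 𝒪[E]) (σO : 𝒪[E] →+* 𝒪[E]) (j : 𝒪[E] →+* O₁) (σ₁ : O₁ →+* O₁) (θ : O₁) {k₀ : 𝒪[E]}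
  (u : 𝒪[E]) {t y D e₂ : 𝒪[E]} {lam : O₁} {ϖ : E} {n N : ℕ} {ϖO : 𝒪[E]} {k₀F ε₀ : 𝒪[F]} {ϖF : F}

/-! ## §1 Preparations: the second coordinate of `r ∈ R`, residual triviality, the witness `η₀ = (ε, jε)` -/

/-- **FOR `r ∈ R = 𝒪_E[x]`: `r.2 = j(r.1 + m) + j(m′)·θ` WITH `m, m′ ∈ 𝔪_E`** (three-term form: `r.1 = c₀ + c₁u + c₂u²`, `r.2 = j(c₀ + c₁e₂t + c₂e₂²(t² + y²ε)) + j(y·(…))θ`, and `u ≡ 1`,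
`e₂t ≡ 1`, `y ∈ 𝔪`). [cite: Neukirch1999, Ch. I §12] -/
theorem snd_sub_map_fst_mem_of_mem_range (hθ : θ ^ 2 = j k₀) (h2 : e₂ * 2 = 1) (hD : 4 * D = t * t - y * y * k₀) (hlam : lam = j (e₂ * t) + j (e₂ * y) * θ)
    (hu1 : u - 1 ∈ IsLocalRing.maximalIdeal 𝒪[E]) (ht2 : t - 2 ∈ IsLocalRing.maximalIdeal 𝒪[E]) (hy : y ∈ IsLocalRing.maximalIdeal 𝒪[E]) {r : 𝒪[E] × O₁}
    (hr : r ∈ (Polynomial.eval₂RingHom (RingHom.prod (RingHom.id 𝒪[E]) j) ((u, lam) : 𝒪[E] × O₁)).range) :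
    ∃ m m' : 𝒪[E], m ∈ IsLocalRing.maximalIdeal 𝒪[E] ∧ m' ∈ IsLocalRing.maximalIdeal 𝒪[E] ∧ r.2 = j (r.1 + m) + j m' * θ := by
  obtain ⟨c, rfl⟩ := (mem_range_eval₂_iff j θ hθ u h2 hD hlam r).1 hr
  obtain ⟨hsq, -⟩ := lam_sq_sub j θ hθ h2 hD hlam
  refine ⟨c 1 * (e₂ * t - u) + c 2 * (e₂ * e₂ * (t * t + y * y * k₀) - u * u), c 1 * (e₂ * y) + c 2 * (2 * e₂ * e₂ * t * y), ?_, ?_, ?_⟩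
  · have h1 : e₂ * t - u = e₂ * (t - 2) - (u - 1) := by linear_combination h2
    have h2' : e₂ * e₂ * (t * t + y * y * k₀) - u * u = e₂ * e₂ * (t + 2) * (t - 2) + e₂ * e₂ * k₀ * y * y - (u + 1) * (u - 1) := by
      linear_combination (e₂ * 2 + 1) * h2
    rw [h1, h2']
    exact Ideal.add_mem _ (Ideal.mul_mem_left _ _ (Ideal.sub_mem _ (Ideal.mul_mem_left _ _ ht2) hu1))
      (Ideal.mul_mem_left _ _ (Ideal.sub_mem _ (Ideal.add_mem _ (Ideal.mul_mem_left _ _ ht2) (Ideal.mul_mem_left _ _ hy)) (Ideal.mul_mem_left _ _ hu1)))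
  · have e : c 1 * (e₂ * y) + c 2 * (2 * e₂ * e₂ * t * y) = (c 1 * e₂ + c 2 * (2 * e₂ * e₂ * t)) * y := by ring
    rw [e]; exact Ideal.mul_mem_left _ _ hy
  · rw [Prod.pow_mk, hsq, hlam]
    simp only [Prod.snd_add, Prod.snd_mul, Prod.fst_add, Prod.fst_mul, map_add, map_mul, map_sub, map_pow, map_ofNat]
    ring

/-- **`σ_E` IS RESIDUALLY TRIVIAL** on the ramified coordinate model: `σ(ιO b + ιO c·Π) − (ιO b + ιO c·Π) = −2ιO c·Π ∈ (Π) = 𝔪_E`. [cite: SerreLocalFields1979, Ch. V §3] -/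
theorem map_sub_self_mem_maximalIdeal_of_coord (hcoordE : ∀ a : 𝒪[E], ∃! bc : 𝒪[F] × 𝒪[F], a = ιO bc.1 + ιO bc.2 * ϖO) (hσι : ∀ b, σO (ιO b) = ιO b)
    (hσϖO : σO ϖO = -ϖO) (hϖOu : IsUniformizingElement (ϖO : E)) (x : 𝒪[E]) : σO x - x ∈ IsLocalRing.maximalIdeal 𝒪[E] := by
  obtain ⟨⟨b, c⟩, rfl, -⟩ := hcoordE x
  have hmE : IsLocalRing.maximalIdeal 𝒪[E] = Ideal.span ({ϖO} : Set 𝒪[E]) := by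
    have h := hϖOu.span_eq
    have e : (⟨(ϖO : E), hϖOu.mem⟩ : 𝒪[E]) = ϖO := rfl
    rw [e] at h; exact h
  rw [hmE, Ideal.mem_span_singleton']
  exact ⟨-(2 * ιO c), by rw [map_add, map_mul, hσι, hσι, hσϖO]; ring⟩

/-- **TYPE A: `σ₁` IS RESIDUALLY TRIVIAL ON `O₁`** — `σ₁(ja + jbθ) − (ja + jbθ) = j(σa − a) + j(σb − b)θ ∈ jΠ·O₁ ⊆ 𝔪_{O₁}` (`jΠ` is a non-unit of `O₁`, ★ p846900 `isUnit_add_mul_iff_of_nonsquare`).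
[cite: SerreLocalFields1979, Ch. V §3] -/
theorem map_sub_self_mem_maximalIdeal_typeA [IsLocalRing O₁] (hθ : θ ^ 2 = j k₀) (hns : ∀ b : 𝒪[E], IsUnit (b * b - k₀))
    (hcoord : ∀ z : O₁, ∃! bc : 𝒪[E] × 𝒪[E], z = j bc.1 + j bc.2 * θ)
    (hcoordE : ∀ a : 𝒪[E], ∃! bc : 𝒪[F] × 𝒪[F], a = ιO bc.1 + ιO bc.2 * ϖO) (hσι : ∀ b, σO (ιO b) = ιO b) (hσϖO : σO ϖO = -ϖO)
    (hϖOu : IsUniformizingElement (ϖO : E)) (hσ₁j : ∀ a, σ₁ (j a) = j (σO a)) (hσ₁θ : σ₁ θ = θ) (z : O₁) :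
    σ₁ z - z ∈ IsLocalRing.maximalIdeal O₁ := by
  obtain ⟨⟨a, b⟩, rfl, -⟩ := hcoord z
  have hmE : IsLocalRing.maximalIdeal 𝒪[E] = Ideal.span ({ϖO} : Set 𝒪[E]) := by
    have h := hϖOu.span_eq
    have e : (⟨(ϖO : E), hϖOu.mem⟩ : 𝒪[E]) = ϖO := rfl
    rw [e] at h; exact h
  have hres := map_sub_self_mem_maximalIdeal_of_coord ιO σO hcoordE hσι hσϖO hϖOu
  obtain ⟨a', ha'⟩ := Ideal.mem_span_singleton'.1 (by have h := hres a; rw [hmE] at h; exact h)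
  obtain ⟨b', hb'⟩ := Ideal.mem_span_singleton'.1 (by have h := hres b; rw [hmE] at h; exact h)
  have hϖOnu : ¬ IsUnit ϖO := by
    rw [Valuation.Integers.isUnit_iff_valuation_eq_one (Valuation.integer.integers (valuation E))]
    exact hϖOu.valuation_lt_one.ne
  have hjϖO : j ϖO ∈ IsLocalRing.maximalIdeal O₁ := by
    rw [IsLocalRing.mem_maximalIdeal, mem_nonunits_iff]
    intro hunit
    have h' : IsUnit (j ϖO + j 0 * θ) := by rw [map_zero, zero_mul, add_zero]; exact hunit
    rcases (isUnit_add_mul_iff_of_nonsquare j θ hθ hns hcoord ϖO 0).1 h' with h1 | h1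
    · exact hϖOnu h1
    · exact not_isUnit_zero h1
  have e : σ₁ (j a + j b * θ) - (j a + j b * θ) = j ϖO * (j a' + j b' * θ) := by
    rw [map_add, map_mul, hσ₁j, hσ₁j, hσ₁θ]
    have ea : j (σO a) - j a = j ϖO * j a' := by rw [← map_sub, ← ha', map_mul, mul_comm]
    have eb : j (σO b) - j b = j ϖO * j b' := by rw [← map_sub, ← hb', map_mul, mul_comm]
    linear_combination ea + θ * eb
  rw [e]
  exact Ideal.mul_mem_right _ _ hjϖO

/-- `ε̄` is not a square when `b² − ε` is a unit for every `b` (the unramified-model hypothesis `hns`). [cite: SerreLocalFields1979, Ch. I §6 Prop. 15] -/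
theorem not_isSquare_residue_of_forall_isUnit (hns : ∀ b : 𝒪[E], IsUnit (b * b - k₀)) : ¬ IsSquare (IsLocalRing.residue 𝒪[E] k₀) := by
  rintro ⟨r, hr⟩
  obtain ⟨b, rfl⟩ := IsLocalRing.residue_surjective r
  have hmem : b * b - k₀ ∈ IsLocalRing.maximalIdeal 𝒪[E] := by rw [← IsLocalRing.residue_eq_zero_iff, map_sub, map_mul, hr, sub_self]
  exact (IsLocalRing.mem_maximalIdeal _ |>.1 hmem) (hns b)

/-- **TYPE A: `ja` IS A `σ₁`-NORM FOR EVERY `σ`-FIXED UNIT `a` OF `𝒪_E`** — by ★ B-p10's dichotomy on `𝒪_E` with the non-square unit `ε = θ²`: `a = sσs` or `a = ε·sσs`, and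
`jε = θ·σ₁θ`. [cite: SerreLocalFields1979, Ch. V §3 Cor. 2] -/
theorem exists_mul_map_eq_map_of_fixed_typeA [IsAdicComplete (IsLocalRing.maximalIdeal 𝒪[E]) 𝒪[E]] [Finite 𝓀[E]]
    (hθ : θ ^ 2 = j k₀) (hns : ∀ b : 𝒪[E], IsUnit (b * b - k₀)) (h2E : IsUnit (2 : 𝒪[E]))
    (hσσ : ∀ a, σO (σO a) = a) (hres : ∀ x : 𝒪[E], σO x - x ∈ IsLocalRing.maximalIdeal 𝒪[E]) (hσk₀ : σO k₀ = k₀)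
    (hσ₁j : ∀ a, σ₁ (j a) = j (σO a)) (hσ₁θ : σ₁ θ = θ) {a : 𝒪[E]} (ha : IsUnit a) (hσa : σO a = a) :
    ∃ z : O₁, z * σ₁ z = j a := by
  have hk₀sq : ¬ IsSquare (IsLocalRing.residue 𝒪[E] k₀) := not_isSquare_residue_of_forall_isUnit hns
  obtain ⟨s, hs | hs⟩ := exists_mul_map_eq_or_eq_mul σO hσσ hres h2E hσk₀ hk₀sq ha hσa
  · exact ⟨j s, by rw [hσ₁j, ← map_mul, hs]⟩
  · refine ⟨θ * j s, ?_⟩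
    rw [map_mul, hσ₁θ, hσ₁j, ← hs, map_mul, map_mul, ← hθ]
    ring

section Assembly

variable [IsDiscreteValuationRing 𝒪[E]] [Finite 𝓀[E]] [Finite 𝓀[F]] [IsAdicComplete (IsLocalRing.maximalIdeal 𝒪[E]) 𝒪[E]]
  [IsLocalRing O₁] [IsAdicComplete (IsLocalRing.maximalIdeal O₁) O₁] [Finite (IsLocalRing.ResidueField O₁)]
  (hθ : θ ^ 2 = j k₀) (hns : ∀ b : 𝒪[E], IsUnit (b * b - k₀)) (hcoord : ∀ z : O₁, ∃! bc : 𝒪[E] × 𝒪[E], z = j bc.1 + j bc.2 * θ)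
  (h2 : e₂ * 2 = 1) (hD : 4 * D = t * t - y * y * k₀) (hlam : lam = j (e₂ * t) + j (e₂ * y) * θ)
  (hu1 : u - 1 ∈ IsLocalRing.maximalIdeal 𝒪[E]) (ht2 : t - 2 ∈ IsLocalRing.maximalIdeal 𝒪[E]) (hϖ : IsUniformizingElement ϖ)
  (hn : valuation E ((u * u - t * u + D : 𝒪[E]) : E) = valuation E ϖ ^ n) (hN : valuation E ((y : 𝒪[E]) : E) = valuation E ϖ ^ N)
  (hσσ : ∀ a, σO (σO a) = a) (hσ₁σ₁ : ∀ z, σ₁ (σ₁ z) = z) (hσ₁j : ∀ a, σ₁ (j a) = j (σO a))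
  (hx1 : ((u, lam) : 𝒪[E] × O₁) * RingHom.prodMap σO σ₁ (u, lam) = 1) (huD : IsUnit (u * D))
  (hcoordE : ∀ a : 𝒪[E], ∃! bc : 𝒪[F] × 𝒪[F], a = ιO bc.1 + ιO bc.2 * ϖO) (hσι : ∀ b, σO (ιO b) = ιO b) (hσϖO : σO ϖO = -ϖO)
  (h2F : ∀ b : 𝒪[F], b * 2 = 0 → b = 0) (hϖOu : IsUniformizingElement (ϖO : E)) (hϖOsq : ϖO * ϖO = ιO k₀F)
  (hϖF : IsUniformizingElement ϖF) (hk₀F : valuation F (k₀F : F) = valuation F ϖF) (hϖOv : valuation E ((ϖO : 𝒪[E]) : E) = valuation E ϖ)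
  (hε₀ : k₀ = ιO ε₀) (hN1 : 1 ≤ N) (hNn : 2 ≤ N + n)

/-! ## §2 The unit index `[C : R^×]` -/

include hθ hns hcoord h2 hD hlam hu1 ht2 hϖ hn hN hσσ hσ₁σ₁ hσ₁j hx1 huD hcoordE hσι hσϖO h2F hϖOu hϖOsq hϖF hk₀F hϖOv hε₀ hN1 hNn in
/-- **THE TYPE-(2) UNIT INDEX AT A TAME-RAMIFIED BASE, TYPE A (`σ₁θ = θ`, `N + n` odd): `[C : R^×] = 2·q^{(N+n−1)∕2}`**, `q = #𝓀_F`, `C = N⁻¹(R^×)`, `N = id·⋆` on `Λ^×`,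
`Λ = 𝒪_E × O₁`, `R = 𝒪_E[(u, λ)]` — A-p19 (g26)'s CERT «[T2-c]-ram» §5 type A, certified at `q = 3, 5`.  See the module docstring for the assembly and the PARITY input
`(hm : Odd (N + n))` (type A ⟺ `N` odd, `n` even — a torus-datum fact discharged by the consumer's transport, not by the index algebra).
[cite: Rogawski1990, §4.9 Lemma 4.9.3 p. 56, Prop. 4.9.1 (b) p. 55] [cite: SerreLocalFields1979, Ch. V §3 Prop. 5 and Cor. 2 p. 86] [cite: Neukirch1999, Ch. I §12] -/
theorem relIndex_units_comap_norm_eq_typeA (hσ₁θ : σ₁ θ = θ) (hm : Odd (N + n)) (hnsF : ∀ b : 𝒪[F], IsUnit (b * b - ε₀)) :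
    (Units.map ((Polynomial.eval₂RingHom (RingHom.prod (RingHom.id 𝒪[E]) j) ((u, lam) : 𝒪[E] × O₁)).range.subtype :
        (Polynomial.eval₂RingHom (RingHom.prod (RingHom.id 𝒪[E]) j) ((u, lam) : 𝒪[E] × O₁)).range →* 𝒪[E] × O₁)).range.relIndex
      ((Units.map ((Polynomial.eval₂RingHom (RingHom.prod (RingHom.id 𝒪[E]) j) ((u, lam) : 𝒪[E] × O₁)).range.subtype :
        (Polynomial.eval₂RingHom (RingHom.prod (RingHom.id 𝒪[E]) j) ((u, lam) : 𝒪[E] × O₁)).range →* 𝒪[E] × O₁)).range.comap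
        (MonoidHom.id (𝒪[E] × O₁)ˣ * Units.map (RingHom.prodMap σO σ₁ : 𝒪[E] × O₁ →* 𝒪[E] × O₁))) =
      2 * Nat.card 𝓀[F] ^ ((N + n - 1) / 2) := by
  classical
  set R := (Polynomial.eval₂RingHom (RingHom.prod (RingHom.id 𝒪[E]) j) ((u, lam) : 𝒪[E] × O₁)).range with hR
  set st : 𝒪[E] × O₁ →+* 𝒪[E] × O₁ := RingHom.prodMap σO σ₁ with hst
  set V := (Units.map (R.subtype : R →* 𝒪[E] × O₁)).range with hV
  set Nm := MonoidHom.id (𝒪[E] × O₁)ˣ * Units.map (st : 𝒪[E] × O₁ →* 𝒪[E] × O₁) with hNm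
  set W := Nm.range with hW
  set G := (RingHom.eqLocus st (RingHom.id (𝒪[E] × O₁))).toSubmonoid.units with hG
  have hq1 : 1 < Nat.card 𝓀[F] := Finite.one_lt_card
  have hy : y ∈ IsLocalRing.maximalIdeal 𝒪[E] := mem_maximalIdeal_of_valuation_eq_pow hϖ (by omega) hN
  have h2E : IsUnit (2 : 𝒪[E]) := IsUnit.of_mul_eq_one_right e₂ h2
  have h2O₁ : IsUnit (2 : O₁) := by have := h2E.map j; rwa [map_ofNat] at this
  have hresE := map_sub_self_mem_maximalIdeal_of_coord ιO σO hcoordE hσι hσϖO hϖOu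
  have hrest := map_sub_self_mem_maximalIdeal_typeA ιO σO j σ₁ θ hθ hns hcoord hcoordE hσι hσϖO hϖOu hσ₁j hσ₁θ
  have hfixE := map_eq_self_iff_of_coord ιO ϖO hcoordE σO hσι hσϖO h2F
  have hfixO : ∀ x, σO x = x → ∃ b, ιO b = x := fun x hx => by obtain ⟨b, hb⟩ := (hfixE x).1 hx; exact ⟨b, hb.symm⟩
  have hιinj : Function.Injective ιO := fun b b' hbb => (coord_unique ιO ϖO hcoordE (by rw [hbb] : ιO b + ιO 0 * ϖO = ιO b' + ιO 0 * ϖO)).1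
  have hstar : ∀ z : 𝒪[E] × O₁, st (st z) = z := star_inv_gen σO σ₁ hσσ hσ₁σ₁
  have hstκ : ∀ c, st (RingHom.prod (RingHom.id 𝒪[E]) j c) = RingHom.prod (RingHom.id 𝒪[E]) j (σO c) := star_const σO j σ₁ hσ₁j
  have hσk₀ : σO k₀ = k₀ := by rw [hε₀, hσι]
  have hk₀u : IsUnit k₀ := by have := hns 0; rwa [zero_mul, zero_sub, IsUnit.neg_iff] at this
  have hk₀sq : ¬ IsSquare (IsLocalRing.residue 𝒪[E] k₀) := not_isSquare_residue_of_forall_isUnit hns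
  have hNval : ∀ v : (𝒪[E] × O₁)ˣ, ((Nm v : (𝒪[E] × O₁)ˣ) : 𝒪[E] × O₁) = (v : 𝒪[E] × O₁) * st v := fun v => by
    rw [hNm, MonoidHom.mul_apply, Units.val_mul, MonoidHom.id_apply, Units.coe_map]; rfl
  have hsR : ∀ r ∈ R, st r ∈ R := fun r hr => (star_mem_range_eval₂_iff σO j σ₁ θ u hθ h2 hD hlam hσσ hσ₁σ₁ hσ₁j hx1 huD r).2 hr
  have hVN : V ≤ V.comap Nm := by
    intro v hv
    rw [Subgroup.mem_comap, hV, mem_range_units_map_subtype_iff, ← map_inv, hNval, hNval]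
    rw [hV, mem_range_units_map_subtype_iff] at hv
    exact ⟨R.mul_mem hv.1 (hsR _ hv.1), R.mul_mem hv.2 (hsR _ hv.2)⟩
  have hWG : W ≤ G := fun g hg => by
    obtain ⟨z, hz⟩ := (mem_range_norm_iff st g).1 hg
    rw [hG, mem_units_eqLocus_iff, ← hz, map_mul, hstar, mul_comm]
  set η₀ : (𝒪[E] × O₁)ˣ := Units.map (RingHom.prod (RingHom.id 𝒪[E]) j : 𝒪[E] →* 𝒪[E] × O₁) hk₀u.unit with hη₀
  have hη₀val : (η₀ : 𝒪[E] × O₁) = (k₀, j k₀) := by rw [hη₀, Units.coe_map, IsUnit.unit_spec]; rfl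
  have hη₀V : η₀ ∈ V := by
    rw [hV, mem_range_units_map_subtype_iff, hη₀, Units.coe_map, Units.coe_map_inv]
    exact ⟨const_mem_range_eval₂ j u _, const_mem_range_eval₂ j u _⟩
  have hη₀G : η₀ ∈ G := by
    rw [hG, mem_units_eqLocus_iff, hη₀val]
    change (σO k₀, σ₁ (j k₀)) = (k₀, j k₀)
    rw [hσ₁j, hσk₀]
  have hη₀sq : ¬ IsSquare (IsLocalRing.residue 𝒪[E] (η₀ : 𝒪[E] × O₁).1) := by rw [hη₀val]; exact hk₀sq
  have hsnd : ∀ h ∈ V ⊓ G, ∃ yy : O₁, yy * σ₁ yy = ((h : (𝒪[E] × O₁)ˣ) : 𝒪[E] × O₁).2 := by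
    intro h hh
    obtain ⟨hhV, hhG⟩ := Subgroup.mem_inf.1 hh
    rw [hV, mem_range_units_map_subtype_iff] at hhV
    have hfix := (mem_units_eqLocus_prodMap_iff σO σ₁ h).1 (by rw [hG] at hhG; exact hhG)
    obtain ⟨hau, hwu⟩ := Prod.isUnit_iff.1 h.isUnit
    set a := ((h : (𝒪[E] × O₁)ˣ) : 𝒪[E] × O₁).1 with ha
    set w := ((h : (𝒪[E] × O₁)ˣ) : 𝒪[E] × O₁).2 with hw
    obtain ⟨m, m', hm1, hm'1, hw'⟩ := snd_sub_map_fst_mem_of_mem_range j θ u hθ h2 hD hlam hu1 ht2 hy hhV.1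
    rw [← hw, ← ha] at hw'
    obtain ⟨z₁, hz₁⟩ := exists_mul_map_eq_map_of_fixed_typeA σO j σ₁ θ hθ hns h2E hσσ hresE hσk₀ hσ₁j hσ₁θ hau hfix.1
    obtain ⟨ai, hai⟩ := hau.exists_left_inv
    set w₁ : O₁ := j ai * w with hw₁
    have hjm : ∀ m₀ ∈ IsLocalRing.maximalIdeal 𝒪[E], j m₀ ∈ IsLocalRing.maximalIdeal O₁ := by
      intro m₀ hm₀
      rw [IsLocalRing.mem_maximalIdeal, mem_nonunits_iff]
      intro hunit
      have h' : IsUnit (j m₀ + j 0 * θ) := by rw [map_zero, zero_mul, add_zero]; exact hunit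
      rcases (isUnit_add_mul_iff_of_nonsquare j θ hθ hns hcoord m₀ 0).1 h' with h1 | h1
      · exact (IsLocalRing.mem_maximalIdeal _ |>.1 hm₀) h1
      · exact not_isUnit_zero h1
    have hw₁1 : w₁ - 1 ∈ IsLocalRing.maximalIdeal O₁ := by
      have e : w₁ - 1 = j (ai * m) + j (ai * m') * θ := by
        rw [hw₁, hw', map_add, map_mul, map_mul]
        have : j ai * j a = 1 := by rw [← map_mul, hai, map_one]
        linear_combination this
      rw [e]
      exact Ideal.add_mem _ (hjm _ (Ideal.mul_mem_left _ _ hm1)) (Ideal.mul_mem_right _ _ (hjm _ (Ideal.mul_mem_left _ _ hm'1)))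
    have hw₁u : IsUnit w₁ := ((IsUnit.of_mul_eq_one a hai).map j).mul hwu
    have hσai : σO ai = ai := by
      have h1 : σO ai * a = 1 := by have := congrArg σO hai; rwa [map_mul, hfix.1, map_one] at this
      calc σO ai = σO ai * (a * ai) := by rw [mul_comm a, hai, mul_one]
        _ = (σO ai * a) * ai := by ring
        _ = ai := by rw [h1, one_mul]
    have hw₁fix : σ₁ w₁ = w₁ := by rw [hw₁, map_mul, hσ₁j, hσai, hfix.2]
    have hw₁sq : IsSquare (IsLocalRing.residue O₁ w₁) := by
      have : IsLocalRing.residue O₁ w₁ = 1 := by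
        rw [← sub_eq_zero, ← map_one (IsLocalRing.residue O₁), ← map_sub, IsLocalRing.residue_eq_zero_iff]; exact hw₁1
      rw [this]; exact IsSquare.one
    obtain ⟨z₂, hz₂⟩ := exists_mul_map_eq_of_isSquare_residue σ₁ hσ₁σ₁ hrest h2O₁ hw₁u hw₁fix hw₁sq
    refine ⟨z₁ * z₂, ?_⟩
    have hjaw₁ : j a * w₁ = w := by rw [hw₁, ← mul_assoc, ← map_mul, mul_comm a, hai, map_one, one_mul]
    rw [← hjaw₁, ← hz₁, ← hz₂, map_mul]; ring
  have hHW : W.relIndex (V ⊓ G) = 2 :=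
    relIndex_range_norm_eq_two_of_snd_norm σO σ₁ hσσ hresE h2E (H := V ⊓ G) inf_le_right (Subgroup.mem_inf.2 ⟨hη₀V, hη₀G⟩) hη₀sq hsnd
  have hGW : W.relIndex G = 4 := relIndex_range_norm_units_eqLocus_eq_four σO σ₁ hσσ hresE h2E hσ₁σ₁ hrest h2O₁
  have hfib := relIndex_comap_norm_mul_relIndex_eq_index st V hVN
  have hidx4 := relIndex_mul_relIndex_eq_relIndex_inf_mul V W G hWG
  have hX₀ := relIndex_units_fixed_mul_sq_eq_typeA ιO σO j σ₁ θ u hθ hns hcoord h2 hD hlam hu1 ht2 hy hσσ hσ₁σ₁ hσι hfixO hιinj hσ₁j hϖ hn hN hcoordE hϖOu hϖOsq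
    hx1 huD hσϖO h2F hϖF hk₀F hϖOv hσ₁θ hm hε₀ hnsF (by omega)
  rw [← Subgroup.inf_relIndex_right V G] at hX₀
  have hVidx := index_units_range_eval₂_eq_of_nonsquare j θ hθ hns hcoord u h2 hD hlam hu1 ht2 hϖ hn hN hN1 hNn
  rw [natCard_residueField_eq_of_ramified_coord ιO hcoordE hϖOu hϖOsq hϖF hk₀F] at hVidx
  rw [hHW, hGW] at hidx4
  rw [hVidx] at hfib
  obtain ⟨k, hk⟩ := hm
  have hk1 : 1 ≤ k := by omega
  have e1 : (N + n + 1) / 2 = k + 1 := by omega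
  have e2 : (N + n - 1) / 2 = k := by omega
  have e3 : N + n - 2 = 2 * k - 1 := by omega
  rw [e1] at hX₀
  rw [e3] at hfib
  rw [e2]
  set c := V.relIndex (V.comap Nm) with hc
  set Y := V.relIndex W with hY
  set X₀ := (V ⊓ G).relIndex G with hX₀def
  set q := Nat.card 𝓀[F] with hq
  have hX₀Y : X₀ = 2 * Y := by omega
  have hq2 : 1 < q ^ 2 := lt_of_lt_of_le hq1 (Nat.le_self_pow two_ne_zero q)
  have hpos : 0 < (q ^ 2 - 1) * q ^ (k + 1) := Nat.mul_pos (Nat.sub_pos_of_lt hq2) (pow_pos (by omega) _)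
  refine Nat.eq_of_mul_eq_mul_right hpos ?_
  have hpow : q ^ 2 * q ^ (2 * k - 1) = q ^ k * q ^ (k + 1) := by
    rw [← pow_add, ← pow_add]; congr 1; omega
  calc c * ((q ^ 2 - 1) * q ^ (k + 1)) = c * (X₀ * q ^ 2) := by rw [hX₀]
    _ = 2 * q ^ 2 * (c * Y) := by rw [hX₀Y]; ring
    _ = 2 * q ^ 2 * ((q ^ 2 - 1) * q ^ (2 * k - 1)) := by rw [hfib]
    _ = 2 * (q ^ 2 - 1) * (q ^ 2 * q ^ (2 * k - 1)) := by ring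
    _ = 2 * q ^ k * ((q ^ 2 - 1) * q ^ (k + 1)) := by rw [hpow]; ring

include hθ hns hcoord h2 hD hlam hu1 ht2 hϖ hn hN hσσ hσ₁σ₁ hσ₁j hx1 huD hcoordE hσι hσϖO h2F hϖOu hϖOsq hϖF hk₀F hϖOv hε₀ hN1 hNn in
/-- **THE TYPE-(2) UNIT INDEX AT A TAME-RAMIFIED BASE, TYPE B (`σ₁θ = −θ`, `N + n` even): `[C : R^×] = (q+1)·q^{(N+n−2)∕2}`**, `q = #𝓀_F` — A-p19 (g26)'s CERT «[T2-c]-ram»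
§5 type B (the `F`-normalised analogue of the inert ★ C3 `relIndex_units_comap_norm_eq`), certified at `q = 3`.  Assembly as in type A with `[G : W] = 2` (every `σ₁`-fixed unit of `O₁`
is a norm: skew unit `σ₁θ − θ = −2θ`) and `[G : V⊓G]·q = (q−1)q^{(N+n)∕2}` (★ (ii-d)); parity input `(hm : Even (N + n))` as in the module docstring.
[cite: Rogawski1990, §4.9 Lemma 4.9.3 p. 56, Prop. 4.9.1 (b) p. 55] [cite: SerreLocalFields1979, Ch. V §2 Prop. 3; Ch. V §3 Cor. 2] [cite: Neukirch1999, Ch. I §12] -/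
theorem relIndex_units_comap_norm_eq_typeB (hσ₁θ : σ₁ θ = -θ) (hm : Even (N + n)) :
    (Units.map ((Polynomial.eval₂RingHom (RingHom.prod (RingHom.id 𝒪[E]) j) ((u, lam) : 𝒪[E] × O₁)).range.subtype :
        (Polynomial.eval₂RingHom (RingHom.prod (RingHom.id 𝒪[E]) j) ((u, lam) : 𝒪[E] × O₁)).range →* 𝒪[E] × O₁)).range.relIndex
      ((Units.map ((Polynomial.eval₂RingHom (RingHom.prod (RingHom.id 𝒪[E]) j) ((u, lam) : 𝒪[E] × O₁)).range.subtype :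
        (Polynomial.eval₂RingHom (RingHom.prod (RingHom.id 𝒪[E]) j) ((u, lam) : 𝒪[E] × O₁)).range →* 𝒪[E] × O₁)).range.comap
        (MonoidHom.id (𝒪[E] × O₁)ˣ * Units.map (RingHom.prodMap σO σ₁ : 𝒪[E] × O₁ →* 𝒪[E] × O₁))) =
      (Nat.card 𝓀[F] + 1) * Nat.card 𝓀[F] ^ ((N + n - 2) / 2) := by
  classical
  set R := (Polynomial.eval₂RingHom (RingHom.prod (RingHom.id 𝒪[E]) j) ((u, lam) : 𝒪[E] × O₁)).range with hR
  set st : 𝒪[E] × O₁ →+* 𝒪[E] × O₁ := RingHom.prodMap σO σ₁ with hst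
  set V := (Units.map (R.subtype : R →* 𝒪[E] × O₁)).range with hV
  set Nm := MonoidHom.id (𝒪[E] × O₁)ˣ * Units.map (st : 𝒪[E] × O₁ →* 𝒪[E] × O₁) with hNm
  set W := Nm.range with hW
  set G := (RingHom.eqLocus st (RingHom.id (𝒪[E] × O₁))).toSubmonoid.units with hG
  have hq1 : 1 < Nat.card 𝓀[F] := Finite.one_lt_card
  have hy : y ∈ IsLocalRing.maximalIdeal 𝒪[E] := mem_maximalIdeal_of_valuation_eq_pow hϖ (by omega) hN
  have h2E : IsUnit (2 : 𝒪[E]) := IsUnit.of_mul_eq_one_right e₂ h2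
  have hresE := map_sub_self_mem_maximalIdeal_of_coord ιO σO hcoordE hσι hσϖO hϖOu
  have hfixE := map_eq_self_iff_of_coord ιO ϖO hcoordE σO hσι hσϖO h2F
  have hfixO : ∀ x, σO x = x → ∃ b, ιO b = x := fun x hx => by obtain ⟨b, hb⟩ := (hfixE x).1 hx; exact ⟨b, hb.symm⟩
  have hιinj : Function.Injective ιO := fun b b' hbb => (coord_unique ιO ϖO hcoordE (by rw [hbb] : ιO b + ιO 0 * ϖO = ιO b' + ιO 0 * ϖO)).1
  have hstar : ∀ z : 𝒪[E] × O₁, st (st z) = z := star_inv_gen σO σ₁ hσσ hσ₁σ₁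
  have hσk₀ : σO k₀ = k₀ := by rw [hε₀, hσι]
  have hk₀u : IsUnit k₀ := by have := hns 0; rwa [zero_mul, zero_sub, IsUnit.neg_iff] at this
  have hk₀sq : ¬ IsSquare (IsLocalRing.residue 𝒪[E] k₀) := not_isSquare_residue_of_forall_isUnit hns
  have hθu : IsUnit θ := by
    have h1 : IsUnit (θ * θ) := by rw [← sq, hθ]; exact hk₀u.map j
    exact isUnit_of_mul_isUnit_left h1
  have hb₀ : IsUnit (σ₁ θ - θ) := by
    rw [hσ₁θ, show -θ - θ = -(2 * θ) by ring, IsUnit.neg_iff]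
    exact (by have := h2E.map j; rwa [map_ofNat] at this : IsUnit (2 : O₁)).mul hθu
  have hNval : ∀ v : (𝒪[E] × O₁)ˣ, ((Nm v : (𝒪[E] × O₁)ˣ) : 𝒪[E] × O₁) = (v : 𝒪[E] × O₁) * st v := fun v => by
    rw [hNm, MonoidHom.mul_apply, Units.val_mul, MonoidHom.id_apply, Units.coe_map]; rfl
  have hsR : ∀ r ∈ R, st r ∈ R := fun r hr => (star_mem_range_eval₂_iff σO j σ₁ θ u hθ h2 hD hlam hσσ hσ₁σ₁ hσ₁j hx1 huD r).2 hr
  have hVN : V ≤ V.comap Nm := by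
    intro v hv
    rw [Subgroup.mem_comap, hV, mem_range_units_map_subtype_iff, ← map_inv, hNval, hNval]
    rw [hV, mem_range_units_map_subtype_iff] at hv
    exact ⟨R.mul_mem hv.1 (hsR _ hv.1), R.mul_mem hv.2 (hsR _ hv.2)⟩
  have hWG : W ≤ G := fun g hg => by
    obtain ⟨z, hz⟩ := (mem_range_norm_iff st g).1 hg
    rw [hG, mem_units_eqLocus_iff, ← hz, map_mul, hstar, mul_comm]
  set η₀ : (𝒪[E] × O₁)ˣ := Units.map (RingHom.prod (RingHom.id 𝒪[E]) j : 𝒪[E] →* 𝒪[E] × O₁) hk₀u.unit with hη₀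
  have hη₀val : (η₀ : 𝒪[E] × O₁) = (k₀, j k₀) := by rw [hη₀, Units.coe_map, IsUnit.unit_spec]; rfl
  have hη₀V : η₀ ∈ V := by
    rw [hV, mem_range_units_map_subtype_iff, hη₀, Units.coe_map, Units.coe_map_inv]
    exact ⟨const_mem_range_eval₂ j u _, const_mem_range_eval₂ j u _⟩
  have hη₀G : η₀ ∈ G := by
    rw [hG, mem_units_eqLocus_iff, hη₀val]
    change (σO k₀, σ₁ (j k₀)) = (k₀, j k₀)
    rw [hσ₁j, hσk₀]
  have hη₀sq : ¬ IsSquare (IsLocalRing.residue 𝒪[E] (η₀ : 𝒪[E] × O₁).1) := by rw [hη₀val]; exact hk₀sq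
  have hHW : W.relIndex (V ⊓ G) = 2 :=
    relIndex_range_norm_eq_two_of_unramified σO σ₁ hσσ hresE h2E hσ₁σ₁ hb₀ (H := V ⊓ G) inf_le_right (Subgroup.mem_inf.2 ⟨hη₀V, hη₀G⟩) hη₀sq
  have hGW : W.relIndex G = 2 := relIndex_range_norm_units_eqLocus_eq_two σO σ₁ hσσ hresE h2E hσ₁σ₁ hb₀
  have hfib := relIndex_comap_norm_mul_relIndex_eq_index st V hVN
  have hidx4 := relIndex_mul_relIndex_eq_relIndex_inf_mul V W G hWG
  have hX₀ := relIndex_units_fixed_mul_eq_typeB ιO σO j σ₁ θ u hθ hns hcoord h2 hD hlam hu1 ht2 hy hσσ hσ₁σ₁ hσι hfixO hιinj hσ₁j hϖ hn hN hcoordE hϖOu hϖOsq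
    hx1 huD hσϖO h2F hϖF hk₀F hϖOv hσ₁θ hm hε₀ (by omega)
  rw [← Subgroup.inf_relIndex_right V G] at hX₀
  have hVidx := index_units_range_eval₂_eq_of_nonsquare j θ hθ hns hcoord u h2 hD hlam hu1 ht2 hϖ hn hN hN1 hNn
  rw [natCard_residueField_eq_of_ramified_coord ιO hcoordE hϖOu hϖOsq hϖF hk₀F] at hVidx
  rw [hHW, hGW] at hidx4
  rw [hVidx] at hfib
  obtain ⟨k, hk⟩ := hm
  have hk1 : 1 ≤ k := by omega
  have e1 : (N + n) / 2 = k := by omega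
  have e2 : (N + n - 2) / 2 = k - 1 := by omega
  have e3 : N + n - 2 = 2 * k - 2 := by omega
  rw [e1] at hX₀
  rw [e3] at hfib
  rw [e2]
  set c := V.relIndex (V.comap Nm) with hc
  set Y := V.relIndex W with hY
  set X₀ := (V ⊓ G).relIndex G with hX₀def
  set q := Nat.card 𝓀[F] with hq
  have hX₀Y : X₀ = Y := by omega
  have hpos : 0 < (q - 1) * q ^ k := Nat.mul_pos (by omega) (pow_pos (by omega) _)
  refine Nat.eq_of_mul_eq_mul_right hpos ?_
  have hsq : q ^ 2 - 1 = (q - 1) * (q + 1) := by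
    obtain ⟨p, hp⟩ : ∃ p, q = p + 1 := ⟨q - 1, by omega⟩
    rw [hp, Nat.add_sub_cancel]
    have h : (p + 1) ^ 2 = p * (p + 1 + 1) + 1 := by ring
    omega
  have hpow : q * q ^ (2 * k - 2) = q ^ (k - 1) * q ^ k := by
    rw [← pow_succ', ← pow_add]; congr 1; omega
  calc c * ((q - 1) * q ^ k) = c * (X₀ * q) := by rw [hX₀]
    _ = q * (c * Y) := by rw [hX₀Y]; ring
    _ = q * ((q ^ 2 - 1) * q ^ (2 * k - 2)) := by rw [hfib]
    _ = (q ^ 2 - 1) * (q * q ^ (2 * k - 2)) := by ring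
    _ = (q + 1) * q ^ (k - 1) * ((q - 1) * q ^ k) := by rw [hpow, hsq]; ring

end Assembly

end Literature.NumberTheory.Automorphic

end
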